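import Literature.MathematicalPhysics.KineticTheory.HardSphereCanonicalTwoCluster
import HarnessLib

/-!
# Two-cluster factorisation of the canonical hard-sphere correlation functions at contact scale

Topic `Literature/MathematicalPhysics/KineticTheory` (sequel of `HardSphereCanonicalTwoCluster`).
Iterating the two-cluster one-step estimate `ksInv2_step` `s` times from the trivial bound, along
the windows `2^{s−i} r` of the one-cluster iteration `ksInv_iterate` (which supplies the base case
`k = 0` at every level) and with the centre separation growing by the current window at each step,
gives, for all large `N`, the comparison

  `|v_{N+1}(Y ++ Y') − g_k(lift_c Y) g_{k'}(lift_{c'} Y')| ≤ δ 4^{k+k'}`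

for clusters of microscopic diameter `≤ L ε_N` at centre distance `≥ M ε_N` (`ksInv2_eventually`),
and, combined with the one-cluster limit `ksInv_eventually`, the **two-cluster factorisation**

  `|v_{N+1}(Y ++ Y') − v_{N+1}(Y) v_{N+1}(Y')| ≤ δ 4^{k+k'}`      (`vcan_append_sub_mul_le`)

of the normalised pinned probabilities of the canonical hard-sphere gas on `𝕋³` (Ruelle's weighted
sup-norm; no cluster property of the infinite-volume state is used: the comparison is with the
product `g_k g_{k'}`, which is what the peeling reproduces).

## References

* D. Ruelle, *Statistical Mechanics: Rigorous Results* (1969), §4.2.2–4.2.3, Thm 4.2.3.  [Ruelle1969]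
* E. Pulvirenti, D. Tsagkarogiannis, Comm. Math. Phys. 316 (2012) 289–306, Thm 2.1, §5.
  [PulvirentiTsagkarogiannis2012]
-/

noncomputable section

open MeasureTheory Set Filter Function Metric
open scoped ENNReal BigOperators Topology Classical

namespace Literature.MathematicalPhysics.KineticTheory

open StatisticalMechanics Literature.Analysis.FluidPDE Literature.Analysis.FunctionSpaces

section Iterate

variable {σ : ℝ} (h : SmallDensity uniformProfile σ)
include h

/-- **The iterated two-cluster estimate**: `s` steps up from the trivial bound at level
`N + 1 − s`, first-cluster windows `2^{s−i} r`, second-cluster window `r' ≤ r`, centre separation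
`2^s r + r' + ε − 2^{s−i} r`, bounds `b_i` of `bseq`. [cite: Ruelle1969, §4.2.3] -/
theorem ksInv2_iterate {N s K : ℕ} {r r' E : ℝ} (hs : s ≤ N + 1) (hεr : hsDiameter σ N ≤ r)
    (hr : 2 ^ s * r ≤ 1 / 4) (hr' : r' ≤ r)
    (hη : ∀ i, 1 ≤ i → i ≤ s → ∀ k, 1 ≤ k → k ≤ K →
      etaErr σ N (N + 1 - s + i) (N + 1 - s + i - k) ≤ E) :
    ∀ i, i ≤ s → ∀ (k k' : ℕ) (Y : Fin k → T3) (Y' : Fin k' → T3) (c c' : T3),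
      (∀ a, Torus.euclidDist (Y a) c < 2 ^ (s - i) * r) →
      (∀ a, Torus.euclidDist (Y' a) c' < r') →
      2 ^ s * r + r' + hsDiameter σ N - 2 ^ (s - i) * r ≤ Torus.euclidDist c c' →
      |vcan (hsDiameter σ N) (N + 1 - s + i) (Fin.append Y Y') -
          gLim σ k (liftAt (hsDiameter σ N) c Y) * gLim σ k' (liftAt (hsDiameter σ N) c' Y')| ≤
        bseq (thetaZero σ) E (2 * (3 / 4) ^ K) i * 4 ^ (k + k') := by
  have hε : 0 < hsDiameter σ N := hsDiameter_pos h.σ_pos N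
  have hr0 : 0 ≤ r := hε.le.trans hεr
  intro i
  induction i with
  | zero =>
    intro _ k k' Y Y' c c' _ _ _
    exact abs_vcan_append_sub_mul_le_two h (by omega) Y Y' _ _
  | succ i ih =>
    intro hi k k' Y Y' c c' hY hY' hcc
    have hpow : (2 : ℝ) ^ (s - i) = 2 * 2 ^ (s - (i + 1)) := by
      rw [← pow_succ', show s - (i + 1) + 1 = s - i by omega]
    have hle : (2 : ℝ) ^ (s - i) * r ≤ 2 ^ s * r :=
      mul_le_mul_of_nonneg_right (pow_le_pow_right₀ (by norm_num) (by omega)) hr0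
    have h1r : hsDiameter σ N ≤ 2 ^ (s - (i + 1)) * r :=
      calc hsDiameter σ N ≤ 1 * r := by rwa [one_mul]
        _ ≤ 2 ^ (s - (i + 1)) * r := mul_le_mul_of_nonneg_right (one_le_pow₀ (by norm_num)) hr0
    have hK := ksInv_iterate h (K := K) (E := E) hs hεr hr hη (i + 1) hi
    refine ksInv2_step h (n := N + 1 - s + (i + 1)) (K := K) (E := E)
      (r := 2 ^ (s - (i + 1)) * r) (r' := r') (b := bseq (thetaZero σ) E (2 * (3 / 4) ^ K) i)
      (D := 2 ^ s * r + r' + hsDiameter σ N - 2 ^ (s - (i + 1)) * r)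
      (by omega) (by omega) h1r ?_ (bseq_nonneg (by positivity) i) ?_
      (fun k hk1 hkK => hη (i + 1) le_add_self hi k hk1 hkK) ?_ ?_ k k' Y Y' c c' hY hY' hcc
    · calc 2 * (2 ^ (s - (i + 1)) * r) = 2 ^ (s - i) * r := by rw [hpow, mul_assoc]
        _ ≤ 2 ^ s * r := hle
        _ ≤ 1 / 4 := hr
    · have : 2 * (2 ^ (s - (i + 1)) * r) = 2 ^ (s - i) * r := by rw [hpow, mul_assoc]
      linarith
    · intro l l' Z Z' d d' hZ hZ' hdd
      rw [show N + 1 - s + (i + 1) - 1 = N + 1 - s + i by omega]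
      refine ih (by omega) l l' Z Z' d d' (fun a => ?_) hZ' ?_
      · rw [hpow, mul_assoc]; exact hZ a
      · rw [hpow] ; linarith
    · exact (hK.mono (hr'.trans (by
        calc r = 1 * r := (one_mul r).symm
          _ ≤ 2 ^ (s - (i + 1)) * r :=
            mul_le_mul_of_nonneg_right (one_le_pow₀ (by norm_num)) hr0)) le_rfl)

/-- **The two-cluster comparison at contact scale, eventually**: for every window `L` and `δ > 0`
there is a separation `M > 0` such that, for all large `N`, clusters `Y` (within `L ε_N` of `c`) and
`Y'` (within `L ε_N` of `c'`) with `d(c, c') ≥ M ε_N` satisfy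
`|v_{N+1}(Y ++ Y') − g_k(lift_c Y) g_{k'}(lift_{c'} Y')| ≤ δ 4^{k+k'}`.
[cite: Ruelle1969, §4.2.3 Thm 4.2.3; PulvirentiTsagkarogiannis2012, Thm 2.1] -/
theorem ksInv2_eventually (L : ℝ) {δ : ℝ} (hδ : 0 < δ) :
    ∃ M : ℝ, 0 < M ∧ ∀ᶠ N in atTop, ∀ (k k' : ℕ) (Y : Fin k → T3) (Y' : Fin k' → T3) (c c' : T3),
      (∀ a, Torus.euclidDist (Y a) c < L * hsDiameter σ N) →
      (∀ a, Torus.euclidDist (Y' a) c' < L * hsDiameter σ N) →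
      M * hsDiameter σ N ≤ Torus.euclidDist c c' →
      |vcan (hsDiameter σ N) (N + 1) (Fin.append Y Y') -
          gLim σ k (liftAt (hsDiameter σ N) c Y) * gLim σ k' (liftAt (hsDiameter σ N) c' Y')| ≤
        δ * 4 ^ (k + k') := by
  have hθ0 : 0 ≤ thetaZero σ := thetaZero_nonneg
  have hθ1 : thetaZero σ < 1 := thetaZero_lt_one h
  have hden : 0 < 1 - thetaZero σ := by linarith
  -- the number of steps `s`, the truncation `K` and the error level `E`
  obtain ⟨s, hs⟩ : ∃ s : ℕ, thetaZero σ ^ s < δ / 6 := exists_pow_lt_of_lt_one (by positivity) hθ1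
  obtain ⟨K, hK⟩ : ∃ K : ℕ, (3 / 4 : ℝ) ^ K < (1 - thetaZero σ) * δ / 6 :=
    exists_pow_lt_of_lt_one (by positivity) (by norm_num)
  set E := (1 - thetaZero σ) * δ / 3 with hE
  have hE0 : 0 < E := by positivity
  set τ := 2 * (3 / 4 : ℝ) ^ K with hτ
  have hτ0 : 0 ≤ τ := by positivity
  have hb : bseq (thetaZero σ) E τ s ≤ δ := by
    refine (bseq_le hθ0 hθ1 hE0.le hτ0 s).trans ?_
    have h1 : (E + τ) / (1 - thetaZero σ) ≤ 2 * δ / 3 := by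
      rw [div_le_iff₀ hden]
      have : τ ≤ (1 - thetaZero σ) * δ / 3 := by rw [hτ]; linarith
      linarith
    linarith
  -- the window and the separation
  set L' := max L 1 with hL'
  have hL'1 : 1 ≤ L' := le_max_right _ _
  refine ⟨2 ^ s * L' + L' + 1, by positivity, ?_⟩
  -- eventually: enough particles, small window, small coefficient errors
  have ev1 : ∀ᶠ N : ℕ in atTop, s ≤ N + 1 := by
    filter_upwards [eventually_ge_atTop s] with N hN; omega
  have ev2 : ∀ᶠ N : ℕ in atTop, 2 ^ s * (L' * hsDiameter σ N) ≤ 1 / 4 := by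
    have := ((tendsto_hsDiameter σ).const_mul (2 ^ s * L'))
    rw [mul_zero] at this
    filter_upwards [this.eventually (eventually_le_nhds (by norm_num : (0 : ℝ) < 1 / 4))] with N hN
    linarith [hN]
  have ev3 : ∀ᶠ N : ℕ in atTop, ∀ i ∈ Finset.range (s + 1), ∀ k ∈ Finset.range (K + 1),
      1 ≤ i → 1 ≤ k → etaErr σ N (N + 1 - s + i) (N + 1 - s + i - k) ≤ E := by
    refine (eventually_all_finset _).2 fun i hi => (eventually_all_finset _).2 fun k hk => ?_
    rw [Finset.mem_range] at hi hk
    have ht := (tendsto_etaErr h (s - i) (s - i + k - 1)).eventually (eventually_lt_nhds hE0)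
    filter_upwards [ht, ev1] with N hN hN1 hi1 hk1
    rw [show N + 1 - s + i = N + 1 - (s - i) by omega,
      show N + 1 - (s - i) - k = N - (s - i + k - 1) by omega]
    exact hN.le
  filter_upwards [ev1, ev2, ev3] with N hN1 hN2 hN3
  intro k k' Y Y' c c' hY hY' hcc
  have hε : 0 < hsDiameter σ N := hsDiameter_pos h.σ_pos N
  have hLL' : L * hsDiameter σ N ≤ L' * hsDiameter σ N :=
    mul_le_mul_of_nonneg_right (le_max_left _ _) hε.le
  have hit := ksInv2_iterate h (K := K) (E := E) hN1 (r := L' * hsDiameter σ N)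
    (r' := L' * hsDiameter σ N) (by nlinarith) hN2 le_rfl
    (fun i hi1 his k hk1 hkK => hN3 i (Finset.mem_range.2 (by omega)) k
      (Finset.mem_range.2 (by omega)) hi1 hk1) s le_rfl k k' Y Y' c c'
    (fun a => by rw [Nat.sub_self, pow_zero, one_mul]; exact (hY a).trans_le hLL')
    (fun a => (hY' a).trans_le hLL') (by
      rw [Nat.sub_self, pow_zero, one_mul]
      have : 0 ≤ L' * hsDiameter σ N := by positivity
      nlinarith)
  rw [show N + 1 - s + s = N + 1 by omega] at hit
  exact hit.trans (mul_le_mul_of_nonneg_right hb (by positivity))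

end Iterate

/-- **Two-cluster factorisation of the canonical correlation functions at contact scale**
(Ruelle's Kirkwood–Salsburg method in the canonical ensemble on `𝕋³`): for the `N + 1`-sphere gas
at small reduced density, for every window `L` and accuracy `δ` there is a separation `M` such that,
for all large `N`, two clusters `Y` (all points within `L ε_N` of a centre `c`) and `Y'` (within
`L ε_N` of `c'`) at centre distance `≥ M ε_N` satisfy
`|v_{N+1}(Y ++ Y') − v_{N+1}(Y) v_{N+1}(Y')| ≤ δ 4^{k+k'}`.
[cite: Ruelle1969, §4.2.3 Thm 4.2.3; PulvirentiTsagkarogiannis2012, Thm 2.1] -/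
theorem vcan_append_sub_mul_le :
    ∀ σ : ℝ, SmallDensity uniformProfile σ → ∀ L : ℝ, 0 < L → ∀ δ : ℝ, 0 < δ →
      ∃ M : ℝ, 0 < M ∧ ∃ N₀ : ℕ, ∀ N : ℕ, N₀ ≤ N →
      ∀ (k k' : ℕ) (Y : Fin k → T3) (Y' : Fin k' → T3) (c c' : T3),
        (∀ a, Torus.euclidDist (Y a) c < L * hsDiameter σ N) →
        (∀ a, Torus.euclidDist (Y' a) c' < L * hsDiameter σ N) →
        M * hsDiameter σ N ≤ Torus.euclidDist c c' →
        |vcan (hsDiameter σ N) (N + 1) (Fin.append Y Y') -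
            vcan (hsDiameter σ N) (N + 1) Y * vcan (hsDiameter σ N) (N + 1) Y'| ≤ δ * 4 ^ (k + k') := by
  intro σ h L _ δ hδ
  have hδ3 : 0 < δ / 3 := by positivity
  obtain ⟨M, hM, hev⟩ := ksInv2_eventually h L hδ3
  obtain ⟨N₀, hN₀⟩ := eventually_atTop.1 (hev.and (ksInv_eventually h L hδ3))
  refine ⟨M, hM, N₀, fun N hN k k' Y Y' c c' hY hY' hcc => ?_⟩
  obtain ⟨h2, h1⟩ := hN₀ N hN
  have e2 := h2 k k' Y Y' c c' hY hY' hcc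
  have e1 := h1 k Y c hY
  have e1' := h1 k' Y' c' hY'
  set v := vcan (hsDiameter σ N) (N + 1) (Fin.append Y Y')
  set vY := vcan (hsDiameter σ N) (N + 1) Y
  set vY' := vcan (hsDiameter σ N) (N + 1) Y'
  set g := gLim σ k (liftAt (hsDiameter σ N) c Y)
  set g' := gLim σ k' (liftAt (hsDiameter σ N) c' Y')
  have hvY : |vY| ≤ 2 ^ k := abs_vcan_le h le_rfl Y
  have hg' : |g'| ≤ 3 ^ k' := abs_gLim_le h k' _
  have h24 : (2 : ℝ) ^ k ≤ 4 ^ k := pow_le_pow_left₀ (by norm_num) (by norm_num) _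
  have h34 : (3 : ℝ) ^ k' ≤ 4 ^ k' := pow_le_pow_left₀ (by norm_num) (by norm_num) _
  have key : v - vY * vY' = (v - g * g') + (g - vY) * g' + vY * (g' - vY') := by ring
  rw [key]
  calc _ ≤ |v - g * g'| + |(g - vY) * g'| + |vY * (g' - vY')| := abs_add_three _ _ _
    _ = |v - g * g'| + |vY - g| * |g'| + |vY| * |vY' - g'| := by
        rw [abs_mul, abs_mul, abs_sub_comm g vY, abs_sub_comm g' vY']
    _ ≤ δ / 3 * 4 ^ (k + k') + δ / 3 * 4 ^ k * 3 ^ k' + 2 ^ k * (δ / 3 * 4 ^ k') :=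
        add_le_add (add_le_add e2 (mul_le_mul e1 hg' (abs_nonneg _) (by positivity)))
          (mul_le_mul hvY e1' (abs_nonneg _) (by positivity))
    _ ≤ δ / 3 * 4 ^ (k + k') + δ / 3 * 4 ^ k * 4 ^ k' + 4 ^ k * (δ / 3 * 4 ^ k') := by
        gcongr
    _ = δ * 4 ^ (k + k') := by rw [pow_add]; ring

end Literature.MathematicalPhysics.KineticTheory
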